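import Literature.NumberTheory.EllipticCurves.Kato2004.EulerSystemDefinedValues
import Literature.NumberTheory.EllipticCurves.Kato2004.ZetaBodyFrameRotationProofs
import Mathlib.NumberTheory.Padics.Hensel
import HarnessLib

/-!
# Kato's matrix with the dual exponential DEFINED (`Kato2004.DefinedExpStarBody`) is invariant under a common
# `ℤ_pˣ`-rescaling of the generator and of the classes: `(d, Λ, z) ↦ (ν•d, ν⁻¹•Λ, ν•z)`

`Proofs`-style companion of `EulerSystemDefinedValues.lean` (THEOREMS ONLY: no definition, no named fact, no instance, no
notation, no `sorry`).  Seat `bsd-input-ty-h` g0 (literature TYPER τ3 of cell `pub/bsd-wall/bsd-inputs`, «inputs → unconditional»,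
`--supports stmt-BirchSwinnertonDyer-22680`, helper).  HONEST FRAMING: nothing here proves the fact
`exists_eulerSystem_definedExpStar_values` or `F := exists_eulerSystem_expStar_tatePairing_values_two`; no `_holds`, no item
closed; no summit statement (`BirchSwinnertonDyer`) is proved or advanced by this file.

## What is proved

* `expStarCoord_smul_generator` — the scale law of the tree's scalar dual exponential of an elliptic curve over a `p`-adic field:
  `exp*_{e•d}(η) = e⁻¹ · exp*_d(η)` (`PAdicHodge.expStarCoord` unfolded to `PeriodRingData.dualExpCoord`; the tree's
  `FilZeroLine.dualExpCoord_smul`). [Kato LNM 1553 II §1.2.4, Ex. 1.3.5]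
* **`definedExpStarBody_units_smul`** — for every `ν ∈ ℤ_pˣ` (read in `ℚ_v` as `e` through Mathlib's `ℚ_p ≃ ℚ_v`):
  `DefinedExpStarBody W p f d ι κK Λ → DefinedExpStarBody W p f (e • d) ι κK (ν⁻¹ • Λ)`.  (RES): both sides of the restriction
  compatibility scale by `e⁻¹` (the tower generator is rescaled to `e • d_{w₀}`); (DEF): `Ψ(ν⁻¹ • Λ y)_w = e⁻¹ · Ψ(Λ y)_w` by the
  displayed property of `Ψ`, and `σ_{w₀→w}(e⁻¹ · X) = e⁻¹ · σ_{w₀→w}(X)` (`galAdicCompletionMap` is `ℚ_v`-linear); the `ZetaBody` half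
  holds with the witnesses `(ν • z, x)` — SAME values `x` — by `zetaBody_units_smul` (`ZetaBodyFrameRotationProofs.lean`).
* `exists_definedExpStarBody_units_smul` — the same with the rescaled generator existentially packaged.

## Why (recorded, not asserted; evidence note INPUT-H-IOTA-PIN-XB-D-AUDIT.md of this seat on item 22680, §3)

The hypotheses `hK`/`hB` of `exists_eulerSystem_expStar_tatePairing_values_two_of_definedExpStarBody` share the antecedent
`DefinedExpStarBody W 2 f d ι κK Λ`; by this file that antecedent cannot distinguish `(d, Λ)` from `(ν•d, ν⁻¹•Λ)` for a `2`-adic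
unit `ν` (Kato's class and `ν` times it, with the generator co-scaled, have the SAME rational values), while the conclusion of `hB`
(the layer pairing law with ONE RATIONAL constant `u`) is not invariant (`u ↦ ν u`).  So «rational `exp*`-values» does not pin the
generator to a `ℚˣ`-class; the Néron normalisation is a genuine further input (road (A) of `PAdicHodge/NeronDeRhamDatum.lean`).

## References

* K. Kato, LNM 1553 (1993), Ch. II §1.2.4 and Ex. 1.3.5 (`exp*` along a generator of `D⁰_dR`). [Kato1993LNM1553]
* K. Kato, Astérisque 295 (2004), §9.4 p. 188, Thm. 9.7 p. 189, (8.1.3) p. 180, Ex. 13.3 p. 225. [Kato2004Asterisque]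
* J. W. S. Cassels, A. Fröhlich, *Algebraic Number Theory* (1967), Ch. II §10 (10.2), Ch. VII §1.1 (`σ_w` is a `K_v`-isomorphism). [CasselsFrohlichANT1967]
* Tree: `Kato2004/EulerSystemDefinedValues.lean` (`DefinedExpStarBody`), `PAdicHodge/NeronDeRhamDatum.lean` (`FilZeroLine.smul`,
  `dualExpCoord_smul`), `PAdicHodge/DualExpElliptic.lean` (`expStarCoord`), `AdelicBaseChange/PadicTensorCompletionGaloisProofs.lean`
  (`galAdicCompletionMap_algebraMap_adicCompletion`), `Kato2004/ZetaBodyFrameRotationProofs.lean` (`zetaBody_units_smul`).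
-/

noncomputable section

open scoped BigOperators NumberField TensorProduct Pointwise
open Polynomial Field IsDedekindDomain NumberField CongruenceSubgroup ValuativeRel
open Literature.NumberTheory.GaloisRepresentations
open Literature.NumberTheory.GaloisRepresentations.PeriodRingData
open Literature.NumberTheory.GaloisRepresentations.IsNonarchimedeanLocalField
open Literature.NumberTheory.PAdicHodge
open Literature.NumberTheory.EllipticCurves Literature.NumberTheory.EllipticCurves.ModularForms
open Literature.NumberTheory.AdelicBaseChange Literature.NumberTheory.Automorphic

namespace Literature.NumberTheory.EllipticCurves.Kato2004

open EulerSystemValues Rat.HeightOneSpectrum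

/-! ## §1 The scale law of `expStarCoord` -/

/-- **`exp*_{e•d}(η) = e⁻¹ · exp*_d(η)`** for the tree's scalar dual exponential of an elliptic curve over a `p`-adic field
(`PAdicHodge.expStarCoord` is `PeriodRingData.dualExpCoord` along `d.ω`; `FilZeroLine.dualExpCoord_smul`).
[cite: Kato1993LNM1553, Ch. II §1.2.4 and Ex. 1.3.5] -/
theorem expStarCoord_smul_generator {K₀ : Type} [Field K₀] [CharZero K₀] (W : WeierstrassCurve K₀) [W.IsElliptic]
    {F : Type} [Field F] [Algebra K₀ F] [ValuativeRel F] [TopologicalSpace F]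
    [IsNonarchimedeanLocalField F] [CharZero F] {p : ℕ} [Fact p.Prime]
    [Fact (¬ IsUnit (p : integerC F))] [IsAdicComplete (Ideal.span {(p : integerC F)}) (integerC F)]
    (hp : valuation F p < 1) [Algebra ℚ_[p] F]
    (d : (bdRPeriodRingData (F := F) (p := p) hp).FilZeroLine (restrictedRationalTateRep W F p))
    {e : F} (he : e ≠ 0) (η : contOneCocycles (restrictedTateRep W F p).toTopRep) :
    expStarCoord W hp (d.smul e he) η = e⁻¹ * expStarCoord W hp d η := by
  unfold expStarCoord
  rw [FilZeroLine.smul_ω, FilZeroLine.dualExpCoord_smul d he]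

/-! ## §2 `DefinedExpStarBody` under `(d, Λ, z) ↦ (ν•d, ν⁻¹•Λ, ν•z)` -/

section Scaling

/-- The left `ℚ_p`-action on `ℚ_p ⊗_ℚ K` is multiplication by `s ⊗ 1`. [folklore] -/
private theorem smul_eq_tmul_one_mul {p : ℕ} [Fact p.Prime] {K : Type*} [CommRing K] [Algebra ℚ K]
    (s : ℚ_[p]) (t : ℚ_[p] ⊗[ℚ] K) : s • t = (s ⊗ₜ[ℚ] (1 : K)) * t := by
  rw [Algebra.smul_def]; rfl

/-- `((ν⁻¹ : ℤ_pˣ) : ℚ_p) = ((ν : ℚ_p))⁻¹`. [folklore] -/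
private theorem coe_units_inv_eq_inv {p : ℕ} [Fact p.Prime] (ν : ℤ_[p]ˣ) :
    (((ν⁻¹ : ℤ_[p]ˣ) : ℤ_[p]) : ℚ_[p]) = (((ν : ℤ_[p]) : ℚ_[p]))⁻¹ := by
  refine (eq_inv_of_mul_eq_one_left ?_)
  rw [← PadicInt.coe_mul, Units.inv_mul, PadicInt.coe_one]

set_option backward.isDefEq.respectTransparency false in
set_option maxHeartbeats 800000 in
/-- **`DefinedExpStarBody` is invariant under `(d, Λ) ↦ (e • d, ν⁻¹ • Λ)` for a `p`-adic unit `ν` (`e` its image in `ℚ_v`),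
the `ZetaBody` witnesses becoming `(ν • z, x)`.**  (RES): `exp*_{e•d_{w₀}} = e⁻¹ exp*_{d_{w₀}}` and `exp*_{e•d} = e⁻¹ exp*_d`
(`dualExpCoord_smul`); (DEF): `Ψ(ν⁻¹•Λ y)_w = e⁻¹ Ψ(Λ y)_w` (the displayed property `hΨ` of the semi-local isomorphism, `ν⁻¹ ↦ e⁻¹`
under `ℚ_p ≃ ℚ_v`) and `σ_{w₀→w}` is `ℚ_v`-linear (`galAdicCompletionMap_algebraMap_adicCompletion`); (C1)–(C5) with `(ν•z, x)`:
`zetaBody_units_smul`.  Read: the matrix — in particular its rationality clause (C4) — does not pin the generator `d` beyond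
`ℤ_pˣ · d`. [cite: Kato2004Asterisque, §9.4 (p. 188), Thm. 9.7 (p. 189)] [cite: Kato1993LNM1553, Ch. II §1.2.4 and Ex. 1.3.5]
[cite: CasselsFrohlichANT1967, Ch. II §10 Theorem (10.2) and Ch. VII §1.1] -/
theorem definedExpStarBody_units_smul (W : WeierstrassCurve ℚ) [W.IsElliptic] (p : ℕ) [Fact p.Prime]
    [ContinuousSMul ℤ_[p] (W.tateModule p)] [Module.Free ℤ_[p] (W.tateModule p)]
    [Module.Finite ℤ_[p] (W.tateModule p)]
    {N : ℕ} [NeZero N] (f : CuspForm (Gamma0 N) 2) {d : _}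
    (ι : (n : ℕ) → (CyclotomicField n ℚ →+* ℂ)) (κK : ℝ)
    (Λ : ∀ (k' : ℕ) (r : Finset (HeightOneSpectrum (𝓞 ℚ))),
      H1 (tateRep W p) (cycSubgroup p k' r) →ₗ[ℤ_[p]] ℚ_[p] ⊗[ℚ] CyclotomicField (cycLevel p k' r) ℚ)
    (ν : ℤ_[p]ˣ)
    (e : NumberField.Place.Completion (Sum.inr ((Rat.HeightOneSpectrum.primesEquiv (R := 𝓞 ℚ)).symm ⟨p, Fact.out⟩) : NumberField.Place ℚ))
    (he : e ≠ 0)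
    (heν : (show (((Rat.HeightOneSpectrum.primesEquiv (R := 𝓞 ℚ)).symm ⟨p, Fact.out⟩).adicCompletion ℚ) from e) =
      Padic.adicCompletionEquiv (𝓞 ℚ) ⟨p, Fact.out⟩ ((ν : ℤ_[p]) : ℚ_[p]))
    (h : Kato2004.DefinedExpStarBody W p f d ι κK Λ) :
    -- the `letI` chain of `DefinedExpStarBody`'s binder `d`, verbatim (so that `d.smul` elaborates against the same structures)
    letI : ValuativeRel (NumberField.Place.Completion (Sum.inr ((Rat.HeightOneSpectrum.primesEquiv (R := 𝓞 ℚ)).symm ⟨p, Fact.out⟩) : NumberField.Place ℚ)) :=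
      inferInstanceAs (ValuativeRel (((Rat.HeightOneSpectrum.primesEquiv (R := 𝓞 ℚ)).symm ⟨p, Fact.out⟩).adicCompletion ℚ))
    letI : TopologicalSpace (NumberField.Place.Completion (Sum.inr ((Rat.HeightOneSpectrum.primesEquiv (R := 𝓞 ℚ)).symm ⟨p, Fact.out⟩) : NumberField.Place ℚ)) :=
      inferInstanceAs (TopologicalSpace (((Rat.HeightOneSpectrum.primesEquiv (R := 𝓞 ℚ)).symm ⟨p, Fact.out⟩).adicCompletion ℚ))
    haveI : IsNonarchimedeanLocalField (NumberField.Place.Completion (Sum.inr ((Rat.HeightOneSpectrum.primesEquiv (R := 𝓞 ℚ)).symm ⟨p, Fact.out⟩) : NumberField.Place ℚ)) :=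
      inferInstanceAs (IsNonarchimedeanLocalField (((Rat.HeightOneSpectrum.primesEquiv (R := 𝓞 ℚ)).symm ⟨p, Fact.out⟩).adicCompletion ℚ))
    haveI : CharZero (NumberField.Place.Completion (Sum.inr ((Rat.HeightOneSpectrum.primesEquiv (R := 𝓞 ℚ)).symm ⟨p, Fact.out⟩) : NumberField.Place ℚ)) := LocalField.charZero_adicCompletion ((Rat.HeightOneSpectrum.primesEquiv (R := 𝓞 ℚ)).symm ⟨p, Fact.out⟩)
    letI : Algebra ℚ_[p] (NumberField.Place.Completion (Sum.inr ((Rat.HeightOneSpectrum.primesEquiv (R := 𝓞 ℚ)).symm ⟨p, Fact.out⟩) : NumberField.Place ℚ)) :=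
      LocalField.adicCompletionPadicAlgebra ((Rat.HeightOneSpectrum.primesEquiv (R := 𝓞 ℚ)).symm ⟨p, Fact.out⟩) p ((natCast_mem_asIdeal_iff_eq_primesEquiv_symm _ (Fact.out : p.Prime)).mpr rfl)
    haveI : Fact (¬ IsUnit ((p : ℕ) : integerC (NumberField.Place.Completion (Sum.inr ((Rat.HeightOneSpectrum.primesEquiv (R := 𝓞 ℚ)).symm ⟨p, Fact.out⟩) : NumberField.Place ℚ)))) :=
      ⟨not_isUnit_natCast_integerC (show valuation (NumberField.Place.Completion (Sum.inr ((Rat.HeightOneSpectrum.primesEquiv (R := 𝓞 ℚ)).symm ⟨p, Fact.out⟩) : NumberField.Place ℚ)) ((p : ℕ) : (NumberField.Place.Completion (Sum.inr ((Rat.HeightOneSpectrum.primesEquiv (R := 𝓞 ℚ)).symm ⟨p, Fact.out⟩) : NumberField.Place ℚ))) < 1 from LocalField.valuation_adicCompletion_natCast_lt_one ((Rat.HeightOneSpectrum.primesEquiv (R := 𝓞 ℚ)).symm ⟨p, Fact.out⟩) p ((natCast_mem_asIdeal_iff_eq_primesEquiv_symm _ (Fact.out : p.Prime)).mpr rfl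))⟩
    haveI := isAdicComplete_integerC_natCast (show valuation (NumberField.Place.Completion (Sum.inr ((Rat.HeightOneSpectrum.primesEquiv (R := 𝓞 ℚ)).symm ⟨p, Fact.out⟩) : NumberField.Place ℚ)) ((p : ℕ) : (NumberField.Place.Completion (Sum.inr ((Rat.HeightOneSpectrum.primesEquiv (R := 𝓞 ℚ)).symm ⟨p, Fact.out⟩) : NumberField.Place ℚ))) < 1 from LocalField.valuation_adicCompletion_natCast_lt_one ((Rat.HeightOneSpectrum.primesEquiv (R := 𝓞 ℚ)).symm ⟨p, Fact.out⟩) p ((natCast_mem_asIdeal_iff_eq_primesEquiv_symm _ (Fact.out : p.Prime)).mpr rfl))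
    Kato2004.DefinedExpStarBody W p f (d.smul e he) ι κK (fun k r => (((ν⁻¹ : ℤ_[p]ˣ) : ℤ_[p]) : ℚ_[p]) • Λ k r) := by
  obtain ⟨hdef, hz⟩ := h
  refine ⟨?_, fun c d' a A hA hc hd => ?_⟩
  · intro k r Ψ hΨ
    obtain ⟨w₀, g, hg, hrest⟩ := hdef k r Ψ hΨ
    refine ⟨w₀, g, hg, ?_⟩
    intro hw₀ _ _ _ hL
    obtain ⟨dw, hRES, hDEF⟩ := hrest hw₀ hL
    letI := LocalField.adicCompletionPadicAlgebra w₀.1 p hw₀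
    have heL : algebraMap (((Rat.HeightOneSpectrum.primesEquiv (R := 𝓞 ℚ)).symm ⟨p, Fact.out⟩).adicCompletion ℚ)
        (w₀.1.adicCompletion (CyclotomicField (cycLevel p k r) ℚ)) e ≠ 0 := (_root_.map_ne_zero _).mpr he
    refine ⟨dw.smul _ heL, ?_, ?_⟩
    · intro η₀ η hη
      rw [FilZeroLine.smul_ω, FilZeroLine.dualExpCoord_smul dw heL, hRES η₀ η hη, expStarCoord_smul_generator,
        map_mul, map_inv₀]
    · intro w y φ'' ψT hφ hψ
      have heν' : Padic.adicCompletionEquiv (𝓞 ℚ) ⟨p, Fact.out⟩ ((ν : ℤ_[p]) : ℚ_[p]) = e := heν.symm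
      -- `Ψ(ν⁻¹ • Λ y)_w = e⁻¹ · Ψ(Λ y)_w`
      have hμ : Ψ ((((ν⁻¹ : ℤ_[p]ˣ) : ℤ_[p]) : ℚ_[p]) • Λ k r y) w =
          algebraMap (((Rat.HeightOneSpectrum.primesEquiv (R := 𝓞 ℚ)).symm ⟨p, Fact.out⟩).adicCompletion ℚ)
            (w.1.adicCompletion (CyclotomicField (cycLevel p k r) ℚ)) e⁻¹ * Ψ (Λ k r y) w := by
        rw [smul_eq_tmul_one_mul, map_mul, Pi.mul_apply, hΨ, map_one, one_mul, coe_units_inv_eq_inv, map_inv₀, heν',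
          map_inv₀]
      rw [LinearMap.smul_apply, hμ, hDEF w y φ'' ψT hφ hψ, FilZeroLine.smul_ω, FilZeroLine.dualExpCoord_smul dw heL,
        map_mul, map_inv₀, map_inv₀, galAdicCompletionMap_algebraMap_adicCompletion]
  · obtain ⟨z, x, hzx⟩ := hz c d' a A hA hc hd
    exact ⟨(ν : ℤ_[p]) • z, x, zetaBody_units_smul ν hzx⟩

set_option backward.isDefEq.respectTransparency false in
/-- **The same, with the rescaled generator packaged existentially**: for every `p`-adic unit `ν` there is a nonzero `e ∈ ℚ_v`
(the image of `ν`) with `DefinedExpStarBody W p f d ι κK Λ → DefinedExpStarBody W p f (e • d) ι κK (ν⁻¹ • Λ)`.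
[cite: Kato2004Asterisque, §9.4 (p. 188), Thm. 9.7 (p. 189)] [cite: Kato1993LNM1553, Ch. II §1.2.4 and Ex. 1.3.5] -/
theorem exists_definedExpStarBody_units_smul (W : WeierstrassCurve ℚ) [W.IsElliptic] (p : ℕ) [Fact p.Prime]
    [ContinuousSMul ℤ_[p] (W.tateModule p)] [Module.Free ℤ_[p] (W.tateModule p)]
    [Module.Finite ℤ_[p] (W.tateModule p)]
    {N : ℕ} [NeZero N] (f : CuspForm (Gamma0 N) 2) {d : _}
    (ι : (n : ℕ) → (CyclotomicField n ℚ →+* ℂ)) (κK : ℝ)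
    (Λ : ∀ (k' : ℕ) (r : Finset (HeightOneSpectrum (𝓞 ℚ))),
      H1 (tateRep W p) (cycSubgroup p k' r) →ₗ[ℤ_[p]] ℚ_[p] ⊗[ℚ] CyclotomicField (cycLevel p k' r) ℚ)
    (ν : ℤ_[p]ˣ) (h : Kato2004.DefinedExpStarBody W p f d ι κK Λ) :
    letI : ValuativeRel (NumberField.Place.Completion (Sum.inr ((Rat.HeightOneSpectrum.primesEquiv (R := 𝓞 ℚ)).symm ⟨p, Fact.out⟩) : NumberField.Place ℚ)) :=
      inferInstanceAs (ValuativeRel (((Rat.HeightOneSpectrum.primesEquiv (R := 𝓞 ℚ)).symm ⟨p, Fact.out⟩).adicCompletion ℚ))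
    letI : TopologicalSpace (NumberField.Place.Completion (Sum.inr ((Rat.HeightOneSpectrum.primesEquiv (R := 𝓞 ℚ)).symm ⟨p, Fact.out⟩) : NumberField.Place ℚ)) :=
      inferInstanceAs (TopologicalSpace (((Rat.HeightOneSpectrum.primesEquiv (R := 𝓞 ℚ)).symm ⟨p, Fact.out⟩).adicCompletion ℚ))
    haveI : IsNonarchimedeanLocalField (NumberField.Place.Completion (Sum.inr ((Rat.HeightOneSpectrum.primesEquiv (R := 𝓞 ℚ)).symm ⟨p, Fact.out⟩) : NumberField.Place ℚ)) :=
      inferInstanceAs (IsNonarchimedeanLocalField (((Rat.HeightOneSpectrum.primesEquiv (R := 𝓞 ℚ)).symm ⟨p, Fact.out⟩).adicCompletion ℚ))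
    haveI : CharZero (NumberField.Place.Completion (Sum.inr ((Rat.HeightOneSpectrum.primesEquiv (R := 𝓞 ℚ)).symm ⟨p, Fact.out⟩) : NumberField.Place ℚ)) := LocalField.charZero_adicCompletion ((Rat.HeightOneSpectrum.primesEquiv (R := 𝓞 ℚ)).symm ⟨p, Fact.out⟩)
    letI : Algebra ℚ_[p] (NumberField.Place.Completion (Sum.inr ((Rat.HeightOneSpectrum.primesEquiv (R := 𝓞 ℚ)).symm ⟨p, Fact.out⟩) : NumberField.Place ℚ)) :=
      LocalField.adicCompletionPadicAlgebra ((Rat.HeightOneSpectrum.primesEquiv (R := 𝓞 ℚ)).symm ⟨p, Fact.out⟩) p ((natCast_mem_asIdeal_iff_eq_primesEquiv_symm _ (Fact.out : p.Prime)).mpr rfl)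
    haveI : Fact (¬ IsUnit ((p : ℕ) : integerC (NumberField.Place.Completion (Sum.inr ((Rat.HeightOneSpectrum.primesEquiv (R := 𝓞 ℚ)).symm ⟨p, Fact.out⟩) : NumberField.Place ℚ)))) :=
      ⟨not_isUnit_natCast_integerC (show valuation (NumberField.Place.Completion (Sum.inr ((Rat.HeightOneSpectrum.primesEquiv (R := 𝓞 ℚ)).symm ⟨p, Fact.out⟩) : NumberField.Place ℚ)) ((p : ℕ) : (NumberField.Place.Completion (Sum.inr ((Rat.HeightOneSpectrum.primesEquiv (R := 𝓞 ℚ)).symm ⟨p, Fact.out⟩) : NumberField.Place ℚ))) < 1 from LocalField.valuation_adicCompletion_natCast_lt_one ((Rat.HeightOneSpectrum.primesEquiv (R := 𝓞 ℚ)).symm ⟨p, Fact.out⟩) p ((natCast_mem_asIdeal_iff_eq_primesEquiv_symm _ (Fact.out : p.Prime)).mpr rfl))⟩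
    haveI := isAdicComplete_integerC_natCast (show valuation (NumberField.Place.Completion (Sum.inr ((Rat.HeightOneSpectrum.primesEquiv (R := 𝓞 ℚ)).symm ⟨p, Fact.out⟩) : NumberField.Place ℚ)) ((p : ℕ) : (NumberField.Place.Completion (Sum.inr ((Rat.HeightOneSpectrum.primesEquiv (R := 𝓞 ℚ)).symm ⟨p, Fact.out⟩) : NumberField.Place ℚ))) < 1 from LocalField.valuation_adicCompletion_natCast_lt_one ((Rat.HeightOneSpectrum.primesEquiv (R := 𝓞 ℚ)).symm ⟨p, Fact.out⟩) p ((natCast_mem_asIdeal_iff_eq_primesEquiv_symm _ (Fact.out : p.Prime)).mpr rfl))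
    ∃ (e : NumberField.Place.Completion (Sum.inr ((Rat.HeightOneSpectrum.primesEquiv (R := 𝓞 ℚ)).symm ⟨p, Fact.out⟩) : NumberField.Place ℚ))
      (he : e ≠ 0),
      Kato2004.DefinedExpStarBody W p f (d.smul e he) ι κK (fun k r => (((ν⁻¹ : ℤ_[p]ˣ) : ℤ_[p]) : ℚ_[p]) • Λ k r) := by
  have hν0 : ((ν : ℤ_[p]) : ℚ_[p]) ≠ 0 := fun h0 => ν.ne_zero (PadicInt.coe_eq_zero.mp h0)
  exact ⟨_, (_root_.map_ne_zero _).mpr hν0, definedExpStarBody_units_smul W p f ι κK Λ ν _ _ rfl h⟩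

end Scaling


/-! ## §3 Certificate: the displayed hypotheses `hK`/`hB` of `…_of_definedExpStarBody` jointly force every layer
Tate-pairing value of the fact's currency to VANISH (the scale defect of the module docstring «Why») -/

section Certificate

open scoped Classical
open WeierstrassCurve Literature.NumberTheory.EllipticCurves.Rank1Residual Literature.NumberTheory.EllipticCurves.Kobayashi2003
  ZpExtension

/-- A `2`-adic unit `ν` with `ν² = −7` (Hensel's lemma for `X² + 7` at `1`: `‖8‖ < ‖2‖²`). [folklore] -/
private theorem exists_units_sq_eq_neg_seven : ∃ ν : ℤ_[2]ˣ, ((ν : ℤ_[2]) : ℚ_[2]) ^ 2 = -7 := by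
  have hev : ∀ w : ℤ_[2], Polynomial.aeval w (Polynomial.X ^ 2 + Polynomial.C (7 : ℤ)) = w ^ 2 + 7 := by
    intro w
    simp only [map_add, map_pow, Polynomial.aeval_X, Polynomial.aeval_C]
    simp
  have hder : Polynomial.derivative (Polynomial.X ^ 2 + Polynomial.C (7 : ℤ)) = Polynomial.C (2 : ℤ) * Polynomial.X := by
    rw [Polynomial.derivative_add, Polynomial.derivative_X_pow, Polynomial.derivative_C, add_zero]
    norm_num
  have hev' : Polynomial.aeval (1 : ℤ_[2]) (Polynomial.derivative (Polynomial.X ^ 2 + Polynomial.C (7 : ℤ))) =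
      ((2 : ℕ) : ℤ_[2]) ^ 1 := by
    rw [hder]
    simp only [map_mul, Polynomial.aeval_C, Polynomial.aeval_X, mul_one, pow_one]
    simp
  have hnorm : ‖Polynomial.aeval (1 : ℤ_[2]) (Polynomial.X ^ 2 + Polynomial.C (7 : ℤ))‖ <
      ‖Polynomial.aeval (1 : ℤ_[2]) (Polynomial.derivative (Polynomial.X ^ 2 + Polynomial.C (7 : ℤ)))‖ ^ 2 := by
    have h8 : Polynomial.aeval (1 : ℤ_[2]) (Polynomial.X ^ 2 + Polynomial.C (7 : ℤ)) = ((2 : ℕ) : ℤ_[2]) ^ 3 := by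
      rw [hev]; norm_num
    rw [h8, hev', PadicInt.norm_p_pow, PadicInt.norm_p_pow]
    norm_num
  obtain ⟨z, hz, -, -, -⟩ := hensels_lemma hnorm
  have hz2 : (z : ℤ_[2]) ^ 2 = -7 := by
    rw [hev] at hz
    linear_combination hz
  have hzu : IsUnit z := by
    rw [PadicInt.isUnit_iff]
    have h7 : ‖(z : ℤ_[2])‖ ^ 2 = 1 := by
      rw [← norm_pow, hz2, norm_neg]
      have : (7 : ℤ_[2]) = ((7 : ℤ) : ℤ_[2]) := by norm_num
      rw [this, PadicInt.norm_intCast_eq_one_iff]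
      exact Int.isCoprime_iff_gcd_eq_one.mpr (by decide)
    nlinarith [norm_nonneg (z : ℤ_[2])]
  refine ⟨hzu.unit, ?_⟩
  have h7c : ((7 : ℤ_[2]) : ℚ_[2]) = 7 := by
    rw [show (7 : ℤ_[2]) = ((7 : ℕ) : ℤ_[2]) by norm_num, PadicInt.coe_natCast]; norm_num
  rw [IsUnit.unit_spec, ← PadicInt.coe_pow, hz2, PadicInt.coe_neg, h7c]

/-- `ℚ_2`-scalars pass through Kato's embedding `ẽ = lift (ℚ_2 → ℚ̄_2) e`: `ẽ(s • t) = s · ẽ(t)`. [folklore] -/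
private theorem lift_smul_apply {K : Type*} [Field K] [Algebra ℚ K] (e : K →ₐ[ℚ] PadicAlgCl 2) (s : ℚ_[2])
    (t : ℚ_[2] ⊗[ℚ] K) :
    Algebra.TensorProduct.lift (algebraMap ℚ_[2] (PadicAlgCl 2)).toRatAlgHom e (fun _ _ ↦ Commute.all _ _) (s • t) =
      algebraMap ℚ_[2] (PadicAlgCl 2) s *
        Algebra.TensorProduct.lift (algebraMap ℚ_[2] (PadicAlgCl 2)).toRatAlgHom e (fun _ _ ↦ Commute.all _ _) t := by
  rw [smul_eq_tmul_one_mul, map_mul, Algebra.TensorProduct.lift_tmul, map_one, mul_one]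
  rfl

/-- A Galois automorphism of `ℚ̄₂/ℚ₂` fixes a `ℚ₂`-scalar in front of an element of `ℚ̄₂`. [folklore] -/
private theorem gal_smul_algebraMap_mul (g : Field.absoluteGaloisGroup ℚ_[2]) (s : ℚ_[2]) (w : PadicAlgCl 2) :
    g • (algebraMap ℚ_[2] (PadicAlgCl 2) s * w) = algebraMap ℚ_[2] (PadicAlgCl 2) s * g • w := by
  rw [Field.absoluteGaloisGroup.smul_def, Field.absoluteGaloisGroup.smul_def, map_mul, AlgEquiv.commutes]

set_option backward.isDefEq.respectTransparency false in
set_option maxHeartbeats 800000 in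
/-- CORE of the certificates below: ONE instance `(d, ι, κK, Λ)` of Kato's defined-`exp*` matrix for `(W, 2, f)` together with the
pairing-law hypothesis `hB` forces every layer Tate-pairing value to vanish (`ν² = −7`, `definedExpStarBody_units_smul`, `hB` twice,
`PadicInt.ext_of_toZModPow`). [cite: Kato2004Asterisque, §9.4 (p. 188), Thm. 9.7 (p. 189)] [cite: Kato1993LNM1553, Ch. II §1.2.4 and Ex. 1.3.5] -/
private theorem tatePairingPk_eq_zero_core
    (hB : ∀ (v : HeightOneSpectrum (𝓞 ℚ)), ((2 : ℕ) : 𝓞 ℚ) ∈ v.asIdeal →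
      ∀ (W : WeierstrassCurve ℚ) [W.IsElliptic] [W.IsGloballyMinimal], GoodSS W 2 →
      ∀ (κ : ZpExtension ℚ 2) (hκ : κ.IsCyclotomic),
      ∀ [NeZero (W.conductorNorm ℤ)] (f : CuspForm (Gamma0 (W.conductorNorm ℤ)) 2), IsNewformOf W f →
      ∀ [ContinuousSMul ℤ_[2] (W.tateModule 2)] [Module.Free ℤ_[2] (W.tateModule 2)]
        [Module.Finite ℤ_[2] (W.tateModule 2)],
      ∀ (Φ : AlgebraicClosure ℚ_[2] ≃ₐ[ℚ] AlgebraicClosure (v.adicCompletion ℚ)) (φ : ℚ_[2] ≃+* v.adicCompletion ℚ),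
        (∀ y : ℚ_[2], Φ (algebraMap ℚ_[2] (AlgebraicClosure ℚ_[2]) y) =
          algebraMap (v.adicCompletion ℚ) (AlgebraicClosure (v.adicCompletion ℚ)) (φ y)) →
      ∀ (e : ∀ k : ℕ, CyclotomicField (cycLevel 2 k ∅) ℚ →ₐ[ℚ] PadicAlgCl 2)
        (τ : ∀ m : ℕ, ZMod (2 ^ m) → Field.absoluteGaloisGroup ℚ_[2]),
        (∀ k : ℕ, e (k + 1) (IsCyclotomicExtension.zeta (cycLevel 2 (k + 1) ∅) ℚ (CyclotomicField (cycLevel 2 (k + 1) ∅) ℚ)) ^ 2 =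
          e k (IsCyclotomicExtension.zeta (cycLevel 2 k ∅) ℚ (CyclotomicField (cycLevel 2 k ∅) ℚ))) →
        (∀ (k : ℕ) (a : ZMod (2 ^ k)), IsUnit a →
          τ k a • e k (IsCyclotomicExtension.zeta (cycLevel 2 k ∅) ℚ (CyclotomicField (cycLevel 2 k ∅) ℚ)) =
            e k (IsCyclotomicExtension.zeta (cycLevel 2 k ∅) ℚ (CyclotomicField (cycLevel 2 k ∅) ℚ)) ^ a.val) →
      ∀ d (ι : (m : ℕ) → (CyclotomicField m ℚ →+* ℂ)) (κK : ℝ)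
        (Λ : ∀ (k : ℕ) (r : Finset (HeightOneSpectrum (𝓞 ℚ))),
          H1 (tateRep W 2) (cycSubgroup 2 k r) →ₗ[ℤ_[2]] ℚ_[2] ⊗[ℚ] CyclotomicField (cycLevel 2 k r) ℚ),
        DefinedExpStarBody W 2 f d ι κK Λ →
      ∃ u : ℚ, u ≠ 0 ∧
        ∀ (n : ℕ) (y : H1 (tateRep W 2) (cycSubgroup 2 (n + 2) ∅)) (Q₀ : localPoints W ℚ_[2])
            (hQv : WeierstrassCurve.Affine.Point.map (W' := W)
                (Φ : AlgebraicClosure ℚ_[2] →ₐ[ℚ] AlgebraicClosure (v.adicCompletion ℚ))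
                (show (W.baseChange (AlgebraicClosure ℚ_[2])).toAffine.Point from Q₀) ∈
              localLayerPointsOfEmb κ (closureEmb (K := ℚ) (v.adicCompletion ℚ)) W n),
            (∀ (X Y : AlgebraicClosure ℚ_[2]) (hXY : (W.baseChange (AlgebraicClosure ℚ_[2])).toAffine.Nonsingular X Y),
                (show (W.baseChange (AlgebraicClosure ℚ_[2])).toAffine.Point from Q₀) = .some X Y hXY → 1 < Valued.v X) →
            ∃ t : ℤ_[2],
              (∀ k : ℕ, CyclotomicLayer.tatePairingPk W κ v n k
                  (levelToLayerTwo W hκ (∅ : Set (HeightOneSpectrum (𝓞 ℚ))) n y) ⟨_, hQv⟩ = PadicInt.toZModPow k t) ∧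
              algebraMap ℚ_[2] (PadicAlgCl 2) (t : ℚ_[2]) =
                (u : PadicAlgCl 2) *
                  ∑ b : (ZMod (2 ^ (n + 2)))ˣ, τ (n + 2) (b : ZMod (2 ^ (n + 2))) •
                    ((∑' i : ℕ, algebraMap ℚ_[2] (PadicAlgCl 2) (PowerSeries.coeff i (W.map (algebraMap ℚ ℚ_[2])).formalLog) *
                        (WeierstrassCurve.Affine.Point.zCoord
                          (show (W.baseChange (AlgebraicClosure ℚ_[2])).toAffine.Point from Q₀)) ^ i) *
                      Algebra.TensorProduct.lift (algebraMap ℚ_[2] (PadicAlgCl 2)).toRatAlgHom (e (n + 2))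
                        (fun _ _ ↦ Commute.all _ _) (Λ (n + 2) ∅ y))) :
    ∀ (v : HeightOneSpectrum (𝓞 ℚ)), ((2 : ℕ) : 𝓞 ℚ) ∈ v.asIdeal →
    ∀ (W : WeierstrassCurve ℚ) [W.IsElliptic] [W.IsGloballyMinimal], GoodSS W 2 →
      ∀ (κ : ZpExtension ℚ 2) (hκ : κ.IsCyclotomic),
        ∀ [NeZero (W.conductorNorm ℤ)] (f : CuspForm (Gamma0 (W.conductorNorm ℤ)) 2), IsNewformOf W f →
        ∀ [ContinuousSMul ℤ_[2] (W.tateModule 2)] [Module.Free ℤ_[2] (W.tateModule 2)]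
          [Module.Finite ℤ_[2] (W.tateModule 2)],
        -- the `2`-adic completion frame: `Φ : ℚ̄₂ ≅ \overline{ℚ_v}` continuous, i.e. over `φ : ℚ₂ ≅ ℚ_v`
        ∀ (Φ : AlgebraicClosure ℚ_[2] ≃ₐ[ℚ] AlgebraicClosure (v.adicCompletion ℚ)) (φ : ℚ_[2] ≃+* v.adicCompletion ℚ),
          (∀ y : ℚ_[2], Φ (algebraMap ℚ_[2] (AlgebraicClosure ℚ_[2]) y) =
            algebraMap (v.adicCompletion ℚ) (AlgebraicClosure (v.adicCompletion ℚ)) (φ y)) →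
        ∀ (e : ∀ k : ℕ, CyclotomicField (cycLevel 2 k ∅) ℚ →ₐ[ℚ] PadicAlgCl 2)
          (τ : ∀ m : ℕ, ZMod (2 ^ m) → Field.absoluteGaloisGroup ℚ_[2]),
          -- the `2`-adic frame: a COHERENT tower `e_{k+1}(ζ_{2^{k+1}})² = e_k(ζ_{2^k})` with Galois lifts `τ_a : e_k(ζ) ↦ e_k(ζ)^a`
          (∀ k : ℕ, e (k + 1) (IsCyclotomicExtension.zeta (cycLevel 2 (k + 1) ∅) ℚ (CyclotomicField (cycLevel 2 (k + 1) ∅) ℚ)) ^ 2 =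
            e k (IsCyclotomicExtension.zeta (cycLevel 2 k ∅) ℚ (CyclotomicField (cycLevel 2 k ∅) ℚ))) →
          (∀ (k : ℕ) (a : ZMod (2 ^ k)), IsUnit a →
            τ k a • e k (IsCyclotomicExtension.zeta (cycLevel 2 k ∅) ℚ (CyclotomicField (cycLevel 2 k ∅) ℚ)) =
              e k (IsCyclotomicExtension.zeta (cycLevel 2 k ∅) ℚ (CyclotomicField (cycLevel 2 k ∅) ℚ)) ^ a.val) →
      ∀ {d : _} (ι : (m : ℕ) → (CyclotomicField m ℚ →+* ℂ)) (κK : ℝ)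
        (Λ : ∀ (k' : ℕ) (r : Finset (HeightOneSpectrum (𝓞 ℚ))),
          H1 (tateRep W 2) (cycSubgroup 2 k' r) →ₗ[ℤ_[2]] ℚ_[2] ⊗[ℚ] CyclotomicField (cycLevel 2 k' r) ℚ),
        Kato2004.DefinedExpStarBody W 2 f d ι κK Λ →
      ∀ (n : ℕ) (y : H1 (tateRep W 2) (cycSubgroup 2 (n + 2) ∅)) (Q₀ : localPoints W ℚ_[2])
        (hQv : WeierstrassCurve.Affine.Point.map (W' := W)
            (Φ : AlgebraicClosure ℚ_[2] →ₐ[ℚ] AlgebraicClosure (v.adicCompletion ℚ))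
            (show (W.baseChange (AlgebraicClosure ℚ_[2])).toAffine.Point from Q₀) ∈
          localLayerPointsOfEmb κ (closureEmb (K := ℚ) (v.adicCompletion ℚ)) W n),
        (∀ (X Y : AlgebraicClosure ℚ_[2]) (hXY : (W.baseChange (AlgebraicClosure ℚ_[2])).toAffine.Nonsingular X Y),
            (show (W.baseChange (AlgebraicClosure ℚ_[2])).toAffine.Point from Q₀) = .some X Y hXY → 1 < Valued.v X) →
        ∀ k : ℕ, CyclotomicLayer.tatePairingPk W κ v n k
            (levelToLayerTwo W hκ (∅ : Set (HeightOneSpectrum (𝓞 ℚ))) n y) ⟨_, hQv⟩ = PadicInt.toZModPow k 0 := by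
  intro v hv W _ _ hss κ hκ _ f hf _ _ _ Φ φ hΦφ e τ he hτ d ι κK Λ hbody n y Q₀ hQv hformal k
  obtain ⟨ν, hν⟩ := exists_units_sq_eq_neg_seven
  have hν0 : ((ν : ℤ_[2]) : ℚ_[2]) ≠ 0 := by
    intro h0; rw [h0] at hν; norm_num at hν
  have hne : Padic.adicCompletionEquiv (𝓞 ℚ) ⟨2, Fact.out⟩ ((ν : ℤ_[2]) : ℚ_[2]) ≠ 0 :=
    (_root_.map_ne_zero _).mpr hν0
  have hbody' := definedExpStarBody_units_smul W 2 f ι κK Λ ν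
    (show NumberField.Place.Completion (Sum.inr ((Rat.HeightOneSpectrum.primesEquiv (R := 𝓞 ℚ)).symm ⟨2, Fact.out⟩) :
      NumberField.Place ℚ) from Padic.adicCompletionEquiv (𝓞 ℚ) ⟨2, Fact.out⟩ ((ν : ℤ_[2]) : ℚ_[2])) hne rfl hbody
  -- the pairing law at both data
  obtain ⟨u, hu, hC6⟩ := hB v hv W hss κ hκ f hf Φ φ hΦφ e τ he hτ d ι κK Λ hbody
  obtain ⟨u', hu', hC6'⟩ := hB v hv W hss κ hκ f hf Φ φ hΦφ e τ he hτ _ ι κK _ hbody'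
  obtain ⟨t, ht, htS⟩ := hC6 n y Q₀ hQv hformal
  obtain ⟨t', ht', htS'⟩ := hC6' n y Q₀ hQv hformal
  -- the residues pin `t`: `t = t'`
  have htt : t = t' := PadicInt.ext_of_toZModPow.mp fun j => by rw [← ht j, ← ht' j]
  -- `S' = ν⁻¹ · S`
  set μ : ℚ_[2] := (((ν⁻¹ : ℤ_[2]ˣ) : ℤ_[2]) : ℚ_[2]) with hμ
  set S := ∑ b : (ZMod (2 ^ (n + 2)))ˣ, τ (n + 2) (b : ZMod (2 ^ (n + 2))) •
      ((∑' i : ℕ, algebraMap ℚ_[2] (PadicAlgCl 2) (PowerSeries.coeff i (W.map (algebraMap ℚ ℚ_[2])).formalLog) *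
          (WeierstrassCurve.Affine.Point.zCoord
            (show (W.baseChange (AlgebraicClosure ℚ_[2])).toAffine.Point from Q₀)) ^ i) *
        Algebra.TensorProduct.lift (algebraMap ℚ_[2] (PadicAlgCl 2)).toRatAlgHom (e (n + 2))
          (fun _ _ ↦ Commute.all _ _) (Λ (n + 2) ∅ y)) with hS
  have hS' : (∑ b : (ZMod (2 ^ (n + 2)))ˣ, τ (n + 2) (b : ZMod (2 ^ (n + 2))) •
      ((∑' i : ℕ, algebraMap ℚ_[2] (PadicAlgCl 2) (PowerSeries.coeff i (W.map (algebraMap ℚ ℚ_[2])).formalLog) *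
          (WeierstrassCurve.Affine.Point.zCoord
            (show (W.baseChange (AlgebraicClosure ℚ_[2])).toAffine.Point from Q₀)) ^ i) *
        Algebra.TensorProduct.lift (algebraMap ℚ_[2] (PadicAlgCl 2)).toRatAlgHom (e (n + 2))
          (fun _ _ ↦ Commute.all _ _) ((μ • Λ (n + 2) ∅) y))) =
      algebraMap ℚ_[2] (PadicAlgCl 2) μ * S := by
    rw [hS, Finset.mul_sum]
    refine Finset.sum_congr rfl fun b _ => ?_
    rw [LinearMap.smul_apply, lift_smul_apply, mul_left_comm, gal_smul_algebraMap_mul]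
  -- `u · S = u' · μ · S`
  have key : ((u : PadicAlgCl 2) - (u' : PadicAlgCl 2) * algebraMap ℚ_[2] (PadicAlgCl 2) μ) * S = 0 := by
    have h1 : algebraMap ℚ_[2] (PadicAlgCl 2) (t : ℚ_[2]) = (u : PadicAlgCl 2) * S := htS
    have h2 : algebraMap ℚ_[2] (PadicAlgCl 2) (t' : ℚ_[2]) = (u' : PadicAlgCl 2) * (algebraMap ℚ_[2] (PadicAlgCl 2) μ * S) := by
      rw [htS', hS']
    rw [← htt] at h2
    rw [sub_mul, h1.symm.trans h2]
    ring
  rcases mul_eq_zero.mp key with h0 | hS0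
  · -- `μ = u/u'` would be rational, contradicting `ν² = −7`
    exfalso
    have hμq : algebraMap ℚ_[2] (PadicAlgCl 2) μ = algebraMap ℚ_[2] (PadicAlgCl 2) ((u / u' : ℚ) : ℚ_[2]) := by
      rw [map_ratCast, Rat.cast_div, eq_div_iff (Rat.cast_ne_zero.mpr hu'), mul_comm]
      exact (sub_eq_zero.mp h0).symm
    have hμq' : μ = ((u / u' : ℚ) : ℚ_[2]) := (algebraMap ℚ_[2] (PadicAlgCl 2)).injective hμq
    have hinv : μ * ((ν : ℤ_[2]) : ℚ_[2]) = 1 := by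
      rw [hμ, ← PadicInt.coe_mul, Units.inv_mul, PadicInt.coe_one]
    have hνq : ((ν : ℤ_[2]) : ℚ_[2]) = ((u' / u : ℚ) : ℚ_[2]) := by
      rw [hμq'] at hinv
      rw [eq_inv_of_mul_eq_one_right hinv, ← Rat.cast_inv, inv_div]
    have h7 : (((u' / u) ^ 2 : ℚ) : ℚ_[2]) = ((-7 : ℚ) : ℚ_[2]) := by
      rw [Rat.cast_pow, ← hνq, hν]
      norm_num
    have h7' : ((u' / u) ^ 2 : ℚ) = -7 := Rat.cast_injective h7
    nlinarith [sq_nonneg (u' / u)]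
  · -- `S = 0`, hence `t = 0`
    have ht0 : (t : ℚ_[2]) = 0 := by
      apply (algebraMap ℚ_[2] (PadicAlgCl 2)).injective
      rw [map_zero, htS, hS0, mul_zero]
    rw [ht k, PadicInt.coe_eq_zero.mp ht0]

set_option backward.isDefEq.respectTransparency false in
set_option maxHeartbeats 800000 in
/-- **Certificate of the scale defect.**  IF (`hK`) Kato's matrix with the defined dual exponential holds at the standard
complex frame for every `W/ℚ` with `W[2]` irreducible, AND (`hB`) every value datum `Λ` of such a matrix satisfies the layer
Tate-pairing law up to ONE RATIONAL unit `u` (the two displayed hypotheses of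
`exists_eulerSystem_expStar_tatePairing_values_two_of_definedExpStarBody`, VERBATIM), AND (`hIrr`) `E[2]` is irreducible at a good
supersingular `2`, THEN for every datum of the fact `exists_eulerSystem_expStar_tatePairing_values_two` every layer Tate-pairing value
`⟨Cor y, Q₀⟩_n` of EVERY class `y ∈ H¹(ℚ(μ_{2^{n+2}}), T₂W)` against every formal layer point `Q₀` VANISHES (all residues are `0`).
Proof: `hK` gives `(d, Λ)`; by `definedExpStarBody_units_smul` the matrix also holds for `(ν•d, ν⁻¹•Λ)` with `ν² = −7`
(`exists_units_sq_eq_neg_seven`); `hB` at both data gives `t = u·S` and `t = u'·ν⁻¹·S` for the SAME intrinsic `t` (residues pin `t`,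
`PadicInt.ext_of_toZModPow`); `ν ∉ ℚ` forces `S = 0`, hence `t = 0`.  Read: {hK, hB} is not a consistent pair of true statements
about elliptic curves (local Tate duality makes the pairing non-degenerate) — the «`u ∈ ℚˣ`» of `hB` presupposes a Néron-normalised
generator, which the antecedent `DefinedExpStarBody` cannot supply.  Nothing here bears on the fact `F` itself.
[cite: Kato2004Asterisque, §9.4 (p. 188), Thm. 9.7 (p. 189), Thm. 12.5 (1) (pp. 221–222)] [cite: Kato1993LNM1553, Ch. II §1.2.4 and Ex. 1.3.5]
[cite: Kobayashi2003, (8.23) (p. 18), (8.28)–(8.29) and Prop. 8.25 (p. 24)] [cite: Rubin1998Durham, §5 displays (1)–(2)] -/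
theorem tatePairingPk_eq_zero_of_definedExpStarBody_pairingLaw
    (hK : ∀ (W : WeierstrassCurve ℚ) [W.IsElliptic]
      [ContinuousSMul ℤ_[2] (W.tateModule 2)] [Module.Free ℤ_[2] (W.tateModule 2)] [Module.Finite ℤ_[2] (W.tateModule 2)],
      W.HasIrreducibleModPGaloisRep 2 →
      ∀ {N : ℕ} [NeZero N] (f : CuspForm (Gamma0 N) 2), IsNewformOf W f →
      ∀ (ιC : (m : ℕ) → (CyclotomicField m ℚ →+* ℂ)),
      (∀ k : ℕ, ιC (cycLevel 2 k ∅) (IsCyclotomicExtension.zeta (cycLevel 2 k ∅) ℚ (CyclotomicField (cycLevel 2 k ∅) ℚ)) =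
        Complex.exp (2 * Real.pi * Complex.I / (cycLevel 2 k ∅ : ℕ))) →
      ∃ d κK Λ, κK ≠ 0 ∧ DefinedExpStarBody W 2 f d ιC κK Λ)
    (hB : ∀ (v : HeightOneSpectrum (𝓞 ℚ)), ((2 : ℕ) : 𝓞 ℚ) ∈ v.asIdeal →
      ∀ (W : WeierstrassCurve ℚ) [W.IsElliptic] [W.IsGloballyMinimal], GoodSS W 2 →
      ∀ (κ : ZpExtension ℚ 2) (hκ : κ.IsCyclotomic),
      ∀ [NeZero (W.conductorNorm ℤ)] (f : CuspForm (Gamma0 (W.conductorNorm ℤ)) 2), IsNewformOf W f →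
      ∀ [ContinuousSMul ℤ_[2] (W.tateModule 2)] [Module.Free ℤ_[2] (W.tateModule 2)]
        [Module.Finite ℤ_[2] (W.tateModule 2)],
      ∀ (Φ : AlgebraicClosure ℚ_[2] ≃ₐ[ℚ] AlgebraicClosure (v.adicCompletion ℚ)) (φ : ℚ_[2] ≃+* v.adicCompletion ℚ),
        (∀ y : ℚ_[2], Φ (algebraMap ℚ_[2] (AlgebraicClosure ℚ_[2]) y) =
          algebraMap (v.adicCompletion ℚ) (AlgebraicClosure (v.adicCompletion ℚ)) (φ y)) →
      ∀ (e : ∀ k : ℕ, CyclotomicField (cycLevel 2 k ∅) ℚ →ₐ[ℚ] PadicAlgCl 2)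
        (τ : ∀ m : ℕ, ZMod (2 ^ m) → Field.absoluteGaloisGroup ℚ_[2]),
        (∀ k : ℕ, e (k + 1) (IsCyclotomicExtension.zeta (cycLevel 2 (k + 1) ∅) ℚ (CyclotomicField (cycLevel 2 (k + 1) ∅) ℚ)) ^ 2 =
          e k (IsCyclotomicExtension.zeta (cycLevel 2 k ∅) ℚ (CyclotomicField (cycLevel 2 k ∅) ℚ))) →
        (∀ (k : ℕ) (a : ZMod (2 ^ k)), IsUnit a →
          τ k a • e k (IsCyclotomicExtension.zeta (cycLevel 2 k ∅) ℚ (CyclotomicField (cycLevel 2 k ∅) ℚ)) =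
            e k (IsCyclotomicExtension.zeta (cycLevel 2 k ∅) ℚ (CyclotomicField (cycLevel 2 k ∅) ℚ)) ^ a.val) →
      ∀ d (ι : (m : ℕ) → (CyclotomicField m ℚ →+* ℂ)) (κK : ℝ)
        (Λ : ∀ (k : ℕ) (r : Finset (HeightOneSpectrum (𝓞 ℚ))),
          H1 (tateRep W 2) (cycSubgroup 2 k r) →ₗ[ℤ_[2]] ℚ_[2] ⊗[ℚ] CyclotomicField (cycLevel 2 k r) ℚ),
        DefinedExpStarBody W 2 f d ι κK Λ →
      ∃ u : ℚ, u ≠ 0 ∧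
        ∀ (n : ℕ) (y : H1 (tateRep W 2) (cycSubgroup 2 (n + 2) ∅)) (Q₀ : localPoints W ℚ_[2])
            (hQv : WeierstrassCurve.Affine.Point.map (W' := W)
                (Φ : AlgebraicClosure ℚ_[2] →ₐ[ℚ] AlgebraicClosure (v.adicCompletion ℚ))
                (show (W.baseChange (AlgebraicClosure ℚ_[2])).toAffine.Point from Q₀) ∈
              localLayerPointsOfEmb κ (closureEmb (K := ℚ) (v.adicCompletion ℚ)) W n),
            (∀ (X Y : AlgebraicClosure ℚ_[2]) (hXY : (W.baseChange (AlgebraicClosure ℚ_[2])).toAffine.Nonsingular X Y),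
                (show (W.baseChange (AlgebraicClosure ℚ_[2])).toAffine.Point from Q₀) = .some X Y hXY → 1 < Valued.v X) →
            ∃ t : ℤ_[2],
              (∀ k : ℕ, CyclotomicLayer.tatePairingPk W κ v n k
                  (levelToLayerTwo W hκ (∅ : Set (HeightOneSpectrum (𝓞 ℚ))) n y) ⟨_, hQv⟩ = PadicInt.toZModPow k t) ∧
              algebraMap ℚ_[2] (PadicAlgCl 2) (t : ℚ_[2]) =
                (u : PadicAlgCl 2) *
                  ∑ b : (ZMod (2 ^ (n + 2)))ˣ, τ (n + 2) (b : ZMod (2 ^ (n + 2))) •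
                    ((∑' i : ℕ, algebraMap ℚ_[2] (PadicAlgCl 2) (PowerSeries.coeff i (W.map (algebraMap ℚ ℚ_[2])).formalLog) *
                        (WeierstrassCurve.Affine.Point.zCoord
                          (show (W.baseChange (AlgebraicClosure ℚ_[2])).toAffine.Point from Q₀)) ^ i) *
                      Algebra.TensorProduct.lift (algebraMap ℚ_[2] (PadicAlgCl 2)).toRatAlgHom (e (n + 2))
                        (fun _ _ ↦ Commute.all _ _) (Λ (n + 2) ∅ y)))
    (hIrr : ∀ (W : WeierstrassCurve ℚ) [W.IsElliptic] [W.IsGloballyMinimal], GoodSS W 2 → W.HasIrreducibleModPGaloisRep 2) :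
    ∀ (v : HeightOneSpectrum (𝓞 ℚ)), ((2 : ℕ) : 𝓞 ℚ) ∈ v.asIdeal →
    ∀ (W : WeierstrassCurve ℚ) [W.IsElliptic] [W.IsGloballyMinimal], GoodSS W 2 →
      ∀ (κ : ZpExtension ℚ 2) (hκ : κ.IsCyclotomic),
        ∀ [NeZero (W.conductorNorm ℤ)] (f : CuspForm (Gamma0 (W.conductorNorm ℤ)) 2), IsNewformOf W f →
        ∀ [ContinuousSMul ℤ_[2] (W.tateModule 2)] [Module.Free ℤ_[2] (W.tateModule 2)]
          [Module.Finite ℤ_[2] (W.tateModule 2)],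
        -- the `2`-adic completion frame: `Φ : ℚ̄₂ ≅ \overline{ℚ_v}` continuous, i.e. over `φ : ℚ₂ ≅ ℚ_v`
        ∀ (Φ : AlgebraicClosure ℚ_[2] ≃ₐ[ℚ] AlgebraicClosure (v.adicCompletion ℚ)) (φ : ℚ_[2] ≃+* v.adicCompletion ℚ),
          (∀ y : ℚ_[2], Φ (algebraMap ℚ_[2] (AlgebraicClosure ℚ_[2]) y) =
            algebraMap (v.adicCompletion ℚ) (AlgebraicClosure (v.adicCompletion ℚ)) (φ y)) →
        ∀ (e : ∀ k : ℕ, CyclotomicField (cycLevel 2 k ∅) ℚ →ₐ[ℚ] PadicAlgCl 2)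
          (τ : ∀ m : ℕ, ZMod (2 ^ m) → Field.absoluteGaloisGroup ℚ_[2]),
          -- the `2`-adic frame: a COHERENT tower `e_{k+1}(ζ_{2^{k+1}})² = e_k(ζ_{2^k})` with Galois lifts `τ_a : e_k(ζ) ↦ e_k(ζ)^a`
          (∀ k : ℕ, e (k + 1) (IsCyclotomicExtension.zeta (cycLevel 2 (k + 1) ∅) ℚ (CyclotomicField (cycLevel 2 (k + 1) ∅) ℚ)) ^ 2 =
            e k (IsCyclotomicExtension.zeta (cycLevel 2 k ∅) ℚ (CyclotomicField (cycLevel 2 k ∅) ℚ))) →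
          (∀ (k : ℕ) (a : ZMod (2 ^ k)), IsUnit a →
            τ k a • e k (IsCyclotomicExtension.zeta (cycLevel 2 k ∅) ℚ (CyclotomicField (cycLevel 2 k ∅) ℚ)) =
              e k (IsCyclotomicExtension.zeta (cycLevel 2 k ∅) ℚ (CyclotomicField (cycLevel 2 k ∅) ℚ)) ^ a.val) →
        -- the complex frame: the STANDARD embeddings at the pure levels (Kato (5.7.1))
        ∀ (ιC : (m : ℕ) → (CyclotomicField m ℚ →+* ℂ)),
        (∀ k : ℕ, ιC (cycLevel 2 k ∅) (IsCyclotomicExtension.zeta (cycLevel 2 k ∅) ℚ (CyclotomicField (cycLevel 2 k ∅) ℚ)) =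
          Complex.exp (2 * Real.pi * Complex.I / (cycLevel 2 k ∅ : ℕ))) →
      ∀ (n : ℕ) (y : H1 (tateRep W 2) (cycSubgroup 2 (n + 2) ∅)) (Q₀ : localPoints W ℚ_[2])
        (hQv : WeierstrassCurve.Affine.Point.map (W' := W)
            (Φ : AlgebraicClosure ℚ_[2] →ₐ[ℚ] AlgebraicClosure (v.adicCompletion ℚ))
            (show (W.baseChange (AlgebraicClosure ℚ_[2])).toAffine.Point from Q₀) ∈
          localLayerPointsOfEmb κ (closureEmb (K := ℚ) (v.adicCompletion ℚ)) W n),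
        (∀ (X Y : AlgebraicClosure ℚ_[2]) (hXY : (W.baseChange (AlgebraicClosure ℚ_[2])).toAffine.Nonsingular X Y),
            (show (W.baseChange (AlgebraicClosure ℚ_[2])).toAffine.Point from Q₀) = .some X Y hXY → 1 < Valued.v X) →
        ∀ k : ℕ, CyclotomicLayer.tatePairingPk W κ v n k
            (levelToLayerTwo W hκ (∅ : Set (HeightOneSpectrum (𝓞 ℚ))) n y) ⟨_, hQv⟩ = PadicInt.toZModPow k 0 := by
  intro v hv W _ _ hss κ hκ _ f hf _ _ _ Φ φ hΦφ e τ he hτ ιC hιC n y Q₀ hQv hformal k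
  obtain ⟨d, κK, Λ, -, hbody⟩ := hK W (hIrr W hss) f hf ιC hιC
  exact tatePairingPk_eq_zero_core hB v hv W hss κ hκ f hf Φ φ hΦφ e τ he hτ ιC κK Λ hbody n y Q₀ hQv hformal k

set_option backward.isDefEq.respectTransparency false in
set_option maxHeartbeats 800000 in
/-- **Certificate of the scale defect against the tree's BOOKED Kato input.**  IF the named fact
`exists_eulerSystem_definedExpStar_values` (Kato 2004 with `exp*` defined, complex frame EXISTENTIAL — the faithful transcription,
`EulerSystemDefinedValues.lean`) holds, AND (`hB`) the displayed pairing-law hypothesis of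
`exists_eulerSystem_expStar_tatePairing_values_two_of_definedExpStarBody` holds, AND (`hIrr`) `E[2]` is irreducible at a good supersingular
`2` (Serre), THEN every layer Tate-pairing value `⟨Cor y, Q₀⟩_n` of the fact's currency vanishes.  So `hB` — «ONE RATIONAL unit `u` for
EVERY datum of the matrix» — is incompatible with {Kato's theorem as booked, Serre, non-degeneracy of the local Tate pairing}: the unit is
rational only for a Néron-normalised generator, which the matrix cannot single out (`definedExpStarBody_units_smul`).  Nothing here bears on
`F` or on the booked fact themselves. [cite: Kato2004Asterisque, §9.4 (p. 188), Thm. 9.7 (p. 189), Ex. 13.3 (pp. 224–225)]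
[cite: Kato1993LNM1553, Ch. II §1.2.4 and Ex. 1.3.5] [cite: Kobayashi2003, (8.28)–(8.29) and Prop. 8.25 (p. 24)] [cite: Rubin1998Durham, §5 displays (1)–(2)] -/
theorem tatePairingPk_eq_zero_of_definedExpStar_values_of_pairingLaw
    (hK0 : exists_eulerSystem_definedExpStar_values)
    (hB : ∀ (v : HeightOneSpectrum (𝓞 ℚ)), ((2 : ℕ) : 𝓞 ℚ) ∈ v.asIdeal →
      ∀ (W : WeierstrassCurve ℚ) [W.IsElliptic] [W.IsGloballyMinimal], GoodSS W 2 →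
      ∀ (κ : ZpExtension ℚ 2) (hκ : κ.IsCyclotomic),
      ∀ [NeZero (W.conductorNorm ℤ)] (f : CuspForm (Gamma0 (W.conductorNorm ℤ)) 2), IsNewformOf W f →
      ∀ [ContinuousSMul ℤ_[2] (W.tateModule 2)] [Module.Free ℤ_[2] (W.tateModule 2)]
        [Module.Finite ℤ_[2] (W.tateModule 2)],
      ∀ (Φ : AlgebraicClosure ℚ_[2] ≃ₐ[ℚ] AlgebraicClosure (v.adicCompletion ℚ)) (φ : ℚ_[2] ≃+* v.adicCompletion ℚ),
        (∀ y : ℚ_[2], Φ (algebraMap ℚ_[2] (AlgebraicClosure ℚ_[2]) y) =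
          algebraMap (v.adicCompletion ℚ) (AlgebraicClosure (v.adicCompletion ℚ)) (φ y)) →
      ∀ (e : ∀ k : ℕ, CyclotomicField (cycLevel 2 k ∅) ℚ →ₐ[ℚ] PadicAlgCl 2)
        (τ : ∀ m : ℕ, ZMod (2 ^ m) → Field.absoluteGaloisGroup ℚ_[2]),
        (∀ k : ℕ, e (k + 1) (IsCyclotomicExtension.zeta (cycLevel 2 (k + 1) ∅) ℚ (CyclotomicField (cycLevel 2 (k + 1) ∅) ℚ)) ^ 2 =
          e k (IsCyclotomicExtension.zeta (cycLevel 2 k ∅) ℚ (CyclotomicField (cycLevel 2 k ∅) ℚ))) →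
        (∀ (k : ℕ) (a : ZMod (2 ^ k)), IsUnit a →
          τ k a • e k (IsCyclotomicExtension.zeta (cycLevel 2 k ∅) ℚ (CyclotomicField (cycLevel 2 k ∅) ℚ)) =
            e k (IsCyclotomicExtension.zeta (cycLevel 2 k ∅) ℚ (CyclotomicField (cycLevel 2 k ∅) ℚ)) ^ a.val) →
      ∀ d (ι : (m : ℕ) → (CyclotomicField m ℚ →+* ℂ)) (κK : ℝ)
        (Λ : ∀ (k : ℕ) (r : Finset (HeightOneSpectrum (𝓞 ℚ))),
          H1 (tateRep W 2) (cycSubgroup 2 k r) →ₗ[ℤ_[2]] ℚ_[2] ⊗[ℚ] CyclotomicField (cycLevel 2 k r) ℚ),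
        DefinedExpStarBody W 2 f d ι κK Λ →
      ∃ u : ℚ, u ≠ 0 ∧
        ∀ (n : ℕ) (y : H1 (tateRep W 2) (cycSubgroup 2 (n + 2) ∅)) (Q₀ : localPoints W ℚ_[2])
            (hQv : WeierstrassCurve.Affine.Point.map (W' := W)
                (Φ : AlgebraicClosure ℚ_[2] →ₐ[ℚ] AlgebraicClosure (v.adicCompletion ℚ))
                (show (W.baseChange (AlgebraicClosure ℚ_[2])).toAffine.Point from Q₀) ∈
              localLayerPointsOfEmb κ (closureEmb (K := ℚ) (v.adicCompletion ℚ)) W n),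
            (∀ (X Y : AlgebraicClosure ℚ_[2]) (hXY : (W.baseChange (AlgebraicClosure ℚ_[2])).toAffine.Nonsingular X Y),
                (show (W.baseChange (AlgebraicClosure ℚ_[2])).toAffine.Point from Q₀) = .some X Y hXY → 1 < Valued.v X) →
            ∃ t : ℤ_[2],
              (∀ k : ℕ, CyclotomicLayer.tatePairingPk W κ v n k
                  (levelToLayerTwo W hκ (∅ : Set (HeightOneSpectrum (𝓞 ℚ))) n y) ⟨_, hQv⟩ = PadicInt.toZModPow k t) ∧
              algebraMap ℚ_[2] (PadicAlgCl 2) (t : ℚ_[2]) =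
                (u : PadicAlgCl 2) *
                  ∑ b : (ZMod (2 ^ (n + 2)))ˣ, τ (n + 2) (b : ZMod (2 ^ (n + 2))) •
                    ((∑' i : ℕ, algebraMap ℚ_[2] (PadicAlgCl 2) (PowerSeries.coeff i (W.map (algebraMap ℚ ℚ_[2])).formalLog) *
                        (WeierstrassCurve.Affine.Point.zCoord
                          (show (W.baseChange (AlgebraicClosure ℚ_[2])).toAffine.Point from Q₀)) ^ i) *
                      Algebra.TensorProduct.lift (algebraMap ℚ_[2] (PadicAlgCl 2)).toRatAlgHom (e (n + 2))
                        (fun _ _ ↦ Commute.all _ _) (Λ (n + 2) ∅ y)))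
    (hIrr : ∀ (W : WeierstrassCurve ℚ) [W.IsElliptic] [W.IsGloballyMinimal], GoodSS W 2 → W.HasIrreducibleModPGaloisRep 2) :
    ∀ (v : HeightOneSpectrum (𝓞 ℚ)), ((2 : ℕ) : 𝓞 ℚ) ∈ v.asIdeal →
    ∀ (W : WeierstrassCurve ℚ) [W.IsElliptic] [W.IsGloballyMinimal], GoodSS W 2 →
      ∀ (κ : ZpExtension ℚ 2) (hκ : κ.IsCyclotomic),
        ∀ [NeZero (W.conductorNorm ℤ)] (f : CuspForm (Gamma0 (W.conductorNorm ℤ)) 2), IsNewformOf W f →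
        ∀ [ContinuousSMul ℤ_[2] (W.tateModule 2)] [Module.Free ℤ_[2] (W.tateModule 2)]
          [Module.Finite ℤ_[2] (W.tateModule 2)],
        -- the `2`-adic completion frame: `Φ : ℚ̄₂ ≅ \overline{ℚ_v}` continuous, i.e. over `φ : ℚ₂ ≅ ℚ_v`
        ∀ (Φ : AlgebraicClosure ℚ_[2] ≃ₐ[ℚ] AlgebraicClosure (v.adicCompletion ℚ)) (φ : ℚ_[2] ≃+* v.adicCompletion ℚ),
          (∀ y : ℚ_[2], Φ (algebraMap ℚ_[2] (AlgebraicClosure ℚ_[2]) y) =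
            algebraMap (v.adicCompletion ℚ) (AlgebraicClosure (v.adicCompletion ℚ)) (φ y)) →
        ∀ (e : ∀ k : ℕ, CyclotomicField (cycLevel 2 k ∅) ℚ →ₐ[ℚ] PadicAlgCl 2)
          (τ : ∀ m : ℕ, ZMod (2 ^ m) → Field.absoluteGaloisGroup ℚ_[2]),
          -- the `2`-adic frame: a COHERENT tower `e_{k+1}(ζ_{2^{k+1}})² = e_k(ζ_{2^k})` with Galois lifts `τ_a : e_k(ζ) ↦ e_k(ζ)^a`
          (∀ k : ℕ, e (k + 1) (IsCyclotomicExtension.zeta (cycLevel 2 (k + 1) ∅) ℚ (CyclotomicField (cycLevel 2 (k + 1) ∅) ℚ)) ^ 2 =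
            e k (IsCyclotomicExtension.zeta (cycLevel 2 k ∅) ℚ (CyclotomicField (cycLevel 2 k ∅) ℚ))) →
          (∀ (k : ℕ) (a : ZMod (2 ^ k)), IsUnit a →
            τ k a • e k (IsCyclotomicExtension.zeta (cycLevel 2 k ∅) ℚ (CyclotomicField (cycLevel 2 k ∅) ℚ)) =
              e k (IsCyclotomicExtension.zeta (cycLevel 2 k ∅) ℚ (CyclotomicField (cycLevel 2 k ∅) ℚ)) ^ a.val) →
      ∀ (n : ℕ) (y : H1 (tateRep W 2) (cycSubgroup 2 (n + 2) ∅)) (Q₀ : localPoints W ℚ_[2])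
        (hQv : WeierstrassCurve.Affine.Point.map (W' := W)
            (Φ : AlgebraicClosure ℚ_[2] →ₐ[ℚ] AlgebraicClosure (v.adicCompletion ℚ))
            (show (W.baseChange (AlgebraicClosure ℚ_[2])).toAffine.Point from Q₀) ∈
          localLayerPointsOfEmb κ (closureEmb (K := ℚ) (v.adicCompletion ℚ)) W n),
        (∀ (X Y : AlgebraicClosure ℚ_[2]) (hXY : (W.baseChange (AlgebraicClosure ℚ_[2])).toAffine.Nonsingular X Y),
            (show (W.baseChange (AlgebraicClosure ℚ_[2])).toAffine.Point from Q₀) = .some X Y hXY → 1 < Valued.v X) →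
        ∀ k : ℕ, CyclotomicLayer.tatePairingPk W κ v n k
            (levelToLayerTwo W hκ (∅ : Set (HeightOneSpectrum (𝓞 ℚ))) n y) ⟨_, hQv⟩ = PadicInt.toZModPow k 0 := by
  intro v hv W _ _ hss κ hκ _ f hf _ _ _ Φ φ hΦφ e τ he hτ n y Q₀ hQv hformal k
  obtain ⟨d, ι, κK, Λ, -, hbody⟩ := exists_eulerSystem_definedExpStar_values_iff.mp hK0 W 2 (hIrr W hss) f hf
  exact tatePairingPk_eq_zero_core hB v hv W hss κ hκ f hf Φ φ hΦφ e τ he hτ ι κK Λ hbody n y Q₀ hQv hformal k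

end Certificate

end Literature.NumberTheory.EllipticCurves.Kato2004

end
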